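import Summits.QuantumFields.YangMills.Theorems.PencilRigidityHypercubicLimitDefs
import Summits.QuantumFields.YangMills.Theorems.LangevinControlUVOSLegsFromFemtoAndGapStubAssemblyCompactness
import Summits.QuantumFields.YangMills.Theorems.LangevinControlUVOSLegsFromFemtoAndGapStubAssemblyPlaneExpansion
import Summits.QuantumFields.YangMills.Theorems.LangevinControlUVOSLegsFromFemtoAndGapStubAssemblyPlaneStrings
import Literature.MathematicalPhysics.QuantumFieldTheory.SchwingerLimitInheritance
import HarnessLib

/-!
# Crux `HypercubicLimit` (stmt-QuantumFields-8646), line `conditional-mean-telescoping`: sub-goal `scaledPlaneLimits`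

Support file (`--supports stmt-QuantumFields-8646`, c2 seat; leg (S) `stub_softLegs` of the closure, reshape 3): the
COMPACTNESS step for the RP-normalised plane-string distributions.  Along any sequence of steps
`(β_k, L_k, a_k, N_k)` on which the a-uniform bound of leg (U) holds at step `k` for every arity `n ≤ k` (shape of
`UniformBound`, normalisation `c_k = N_k^{-1/2}`), there are ONE subsequence `φ` and continuous linear functionals
`Spl n q` on `𝒮((ℝ⁴)ⁿ)` — for EVERY arity and EVERY orientation string — such that
* `‖Spl n q F‖ ≤ (K n^γ)ⁿ ‖F‖_{s n}` for all `F` (Hahn–Banach keeps the bound of the approximants);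
* for non-degenerate `q` and `F ∈ ⁰𝒮ₙ`, `(c_{φ k} a_{φ k}⁴)ⁿ · latticeDistStr (plane string q) F → Spl n q F`
  (arity `0`: evaluation; arity `1`: the centred one-point weights vanish identically; `n ≥ 2`: the sibling toolkit's
  countable compactness theorem `exists_subseq_clm_limit` over the index set `Σ n, (Fin n → Fin 4 × Fin 4)`);
* E3 exactly: `Spl n q (permTest π F) = Spl n (q ∘ π) F` on `⁰𝒮` (the lattice identity `latticeDistStr_permTest`).
Refs: OsterwalderSchrader1975 §2; GlimmJaffe1987 §6.1 (compactness of Schwinger functions from uniform bounds).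
-/

set_option autoImplicit false

noncomputable section

open scoped SchwartzMap BigOperators
open MeasureTheory Filter Topology
open Literature.MathematicalPhysics.QuantumFieldTheory Literature.MathematicalPhysics.QuantumLattice
open Literature.MathematicalPhysics.AQFT
open Literature.Probability.LatticeModels (box Site)
open Summit.QuantumFields.YangMills.Theorems.OSLegsFromFemtoAndGap
open Summit.QuantumFields.YangMills.Cruxes.OSLegsFromFemtoAndGap.DlrCollarTransfer (plane torusE)

namespace Summit.QuantumFields.YangMills.Cruxes.HypercubicLimit.ConditionalMeanTelescoping

variable {G : Type} [Group G] [TopologicalSpace G] [IsTopologicalGroup G] [CompactSpace G]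
  [MeasurableSpace G] [BorelSpace G]

/-! ### Exact lattice facts for plane strings -/

/-- The normalised plane-string distribution at unshifted evaluation points, unfolded:
`latticeDistStr (plane string q) F = Σₓ planeWeight q x · F(a x)`. -/
theorem latticeDistStr_planeObs_apply (r : LatticeRep G) (β : ℝ) (S : ℕ) (a : ℝ) {n : ℕ}
    (q : Fin n → Fin 4 × Fin 4) (F : 𝓢((Fin n → EuclideanSpace ℝ (Fin 4)), ℂ)) :
    latticeDistStr r.ρ β S a (fun i => planeObs r (q i)) (fun i => wilsonTorusMean r.ρ β S (planeObs r (q i))) F =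
      ∑ x ∈ Fintype.piFinset (fun _ : Fin n => box 4 S),
        ((planeWeight r β S q x : ℝ) : ℂ) * F (fun i => a • siteToE (x i)) := by
  rw [latticeDistStr_apply]; rfl

/-- **The centred one-point plane weights vanish identically** (the additive normalisation is the torus mean, which by
torus translation invariance does not depend on the site). -/
theorem latticeDistStr_planeObs_one (r : LatticeRep G) (β : ℝ) (S : ℕ) (a : ℝ) (q : Fin 1 → Fin 4 × Fin 4)
    (F : 𝓢((Fin 1 → EuclideanSpace ℝ (Fin 4)), ℂ)) :
    latticeDistStr r.ρ β S a (fun i => planeObs r (q i)) (fun i => wilsonTorusMean r.ρ β S (planeObs r (q i))) F = 0 := by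
  rw [latticeDistStr_apply]
  refine Finset.sum_eq_zero fun x _ => ?_
  have h0 : torusMomentStr r.ρ β S (fun i => planeObs r (q i))
      (fun i => wilsonTorusMean r.ρ β S (planeObs r (q i))) x = 0 := by
    unfold torusMomentStr
    simp only [Finset.univ_unique, Fin.default_eq_zero, Finset.prod_singleton]
    have hint := integrable_plane_lift (G := G) r β S (q 0) (x 0)
    have hmean : ∫ U, plane G r (q 0) (x 0) (torusLift (2 * S + 1) U)
        ∂(wilsonMeasure (d := 4) (L := 2 * S + 1) r.ρ β) = wilsonTorusMean r.ρ β S (planeObs r (q 0)) :=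
      torusE_plane_eq_wilsonTorusMean (G := G) r β S (q 0) (x 0)
    haveI := isProbabilityMeasure_wilsonMeasure (d := 4) (L := 2 * S + 1) r.ρ r.continuous β
    have h1 : ∫ U, (plane G r (q 0) (x 0) (torusLift (2 * S + 1) U) - wilsonTorusMean r.ρ β S (planeObs r (q 0)))
        ∂(wilsonMeasure (d := 4) (L := 2 * S + 1) r.ρ β) = 0 := by
      rw [integral_sub hint (integrable_const _), hmean]
      simp
    exact h1
  rw [h0, Complex.ofReal_zero, zero_mul]

/-! ### The compactness step -/

/-- **`scaledPlaneLimits`** (registered sub-goal of crux stmt-QuantumFields-8646, c2 seat): joint subsequential limits of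
ALL normalised plane-string distributions with the bound of the approximants, and exact E3 — see the module docstring. -/
theorem scaledPlaneLimits :
    ∀ (G : Type) [Group G] [TopologicalSpace G] [IsTopologicalGroup G] [CompactSpace G] [MeasurableSpace G]
      [BorelSpace G] (r : LatticeRep G) (βs : ℕ → ℝ) (Ls : ℕ → ℕ) (as Ns : ℕ → ℝ) (K : ℝ) (γ s : ℕ),
      0 ≤ K → (∀ k, 0 < Ns k) →
      (∀ n : ℕ, 2 ≤ n → ∀ k : ℕ, n ≤ k → ∀ q : Fin n → Fin 4 × Fin 4, (∀ i, (q i).1 ≠ (q i).2) →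
        ∀ F : 𝓢((Fin n → EuclideanSpace ℝ (Fin 4)), ℂ), IsOffDiagonal F →
          as k ^ (4 * n) * ‖∑ x ∈ Fintype.piFinset (fun _ : Fin n => box 4 (Ls k)),
              ((planeWeight r (βs k) (Ls k) q x : ℝ) : ℂ) * F (fun i => as k • siteToE (x i))‖ ≤
            (K * (n : ℝ) ^ γ * Real.sqrt (Ns k)) ^ n * schwartzNorm (s * n) F) →
      ∃ φ : ℕ → ℕ, StrictMono φ ∧
        ∃ Spl : (n : ℕ) → (Fin n → Fin 4 × Fin 4) → (𝓢((Fin n → EuclideanSpace ℝ (Fin 4)), ℂ) →L[ℂ] ℂ),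
          (∀ (n : ℕ) (q : Fin n → Fin 4 × Fin 4) (F : 𝓢((Fin n → EuclideanSpace ℝ (Fin 4)), ℂ)),
            ‖Spl n q F‖ ≤ (K * (n : ℝ) ^ γ) ^ n * schwartzNorm (s * n) F) ∧
          (∀ (n : ℕ) (q : Fin n → Fin 4 × Fin 4), (∀ i, (q i).1 ≠ (q i).2) →
            ∀ F : 𝓢((Fin n → EuclideanSpace ℝ (Fin 4)), ℂ), IsOffDiagonal F →
              Tendsto (fun k => ((((Real.sqrt (Ns (φ k)))⁻¹ * as (φ k) ^ 4) ^ n : ℝ) : ℂ) *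
                latticeDistStr r.ρ (βs (φ k)) (Ls (φ k)) (as (φ k)) (fun i => planeObs r (q i))
                  (fun i => wilsonTorusMean r.ρ (βs (φ k)) (Ls (φ k)) (planeObs r (q i))) F)
                atTop (𝓝 (Spl n q F))) ∧
          (∀ (n : ℕ) (q : Fin n → Fin 4 × Fin 4) (π : Equiv.Perm (Fin n))
            (F : 𝓢((Fin n → EuclideanSpace ℝ (Fin 4)), ℂ)), IsOffDiagonal F →
              Spl n q (permTest π F) = Spl n (q ∘ π) F) := by
  intro G _ _ _ _ _ _ r βs Ls as Ns K γ s hK hN hU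
  classical
  -- the scalar `λ_k^{(n)} = (c_k a_k⁴)ⁿ`, `c_k = N_k^{-1/2}`
  set lam : ℕ → ℕ → ℝ := fun n k => ((Real.sqrt (Ns k))⁻¹ * as k ^ 4) ^ n with hlam
  -- the approximants (zero outside the regime) over the index set `Σ n, (Fin n → Fin 4 × Fin 4)`
  let ι := Σ n : ℕ, (Fin n → Fin 4 × Fin 4)
  let X : ι → Type := fun i => Fin i.1 → EuclideanSpace ℝ (Fin 4)
  let Tfull : (i : ι) → ℕ → (𝓢(X i, ℂ) →L[ℂ] ℂ) := fun i k =>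
    ((lam i.1 k : ℝ) : ℂ) • latticeDistStr r.ρ (βs k) (Ls k) (as k) (fun j => planeObs r (i.2 j))
      (fun j => wilsonTorusMean r.ρ (βs k) (Ls k) (planeObs r (i.2 j)))
  let T : (i : ι) → ℕ → (𝓢(X i, ℂ) →L[ℂ] ℂ) := fun i k =>
    if (∀ j, (i.2 j).1 ≠ (i.2 j).2) ∧ (i.1 = 0 ∨ (2 ≤ i.1 ∧ i.1 ≤ k)) then Tfull i k else 0
  let M : (i : ι) → Submodule ℂ 𝓢(X i, ℂ) := fun i =>
    { carrier := {F | IsOffDiagonal F}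
      add_mem' := fun hF hG => hF.add hG
      zero_mem' := isOffDiagonal_zero
      smul_mem' := fun c _ hF => hF.smul c }
  have hM : ∀ i (F : 𝓢(X i, ℂ)), F ∈ M i ↔ IsOffDiagonal F := fun i F => Iff.rfl
  -- the uniform bound of the approximants
  have hTfull_apply : ∀ (i : ι) (k : ℕ) (F : 𝓢(X i, ℂ)), Tfull i k F =
      ((lam i.1 k : ℝ) : ℂ) * latticeDistStr r.ρ (βs k) (Ls k) (as k) (fun j => planeObs r (i.2 j))
        (fun j => wilsonTorusMean r.ρ (βs k) (Ls k) (planeObs r (i.2 j))) F := fun i k F => rfl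
  have hbound : ∀ i k, ∀ F ∈ M i, ‖T i k F‖ ≤ (K * (i.1 : ℝ) ^ γ) ^ i.1 * schwartzNorm (s * i.1) F := by
    rintro ⟨n, q⟩ k F hF
    rw [hM] at hF
    have hrhs0 : 0 ≤ (K * (n : ℝ) ^ γ) ^ n * schwartzNorm (s * n) F :=
      mul_nonneg (pow_nonneg (by positivity) n) (schwartzNorm_nonneg _ _)
    change ‖(if (∀ j, (q j).1 ≠ (q j).2) ∧ (n = 0 ∨ (2 ≤ n ∧ n ≤ k)) then Tfull ⟨n, q⟩ k else 0) F‖ ≤ _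
    split_ifs with hcond
    · obtain ⟨hq, hn | ⟨hn2, hnk⟩⟩ := hcond
      · -- arity 0: evaluation
        subst hn
        rw [hTfull_apply]
        change ‖((lam 0 k : ℝ) : ℂ) * latticeDistStr r.ρ (βs k) (Ls k) (as k) _ _ F‖ ≤ _
        rw [hlam]; dsimp only
        rw [pow_zero, Complex.ofReal_one, one_mul, latticeDistStr_apply]
        have hS : Fintype.piFinset (fun _ : Fin 0 => box 4 (Ls k)) = {fun i => Fin.elim0 i} := by
          ext x
          simp only [Fintype.mem_piFinset, IsEmpty.forall_iff, Finset.mem_singleton, true_iff]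
          exact funext fun i => Fin.elim0 i
        rw [hS, Finset.sum_singleton]
        have hW : torusMomentStr r.ρ (βs k) (Ls k) (fun j => planeObs r (q j))
            (fun j => wilsonTorusMean r.ρ (βs k) (Ls k) (planeObs r (q j))) (fun i => Fin.elim0 i) = 1 := by
          haveI := isProbabilityMeasure_wilsonMeasure (d := 4) (L := 2 * Ls k + 1) r.ρ r.continuous (βs k)
          simp [torusMomentStr]
        rw [hW, Complex.ofReal_one, one_mul]
        simpa using norm_le_schwartzNorm (s * 0) F _
      · -- arity ≥ 2 inside the regime: the a-uniform bound
        rw [hTfull_apply, norm_mul, Complex.norm_real, Real.norm_eq_abs, hlam]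
        dsimp only
        rw [latticeDistStr_planeObs_apply]
        have hsq : 0 < Real.sqrt (Ns k) := Real.sqrt_pos.2 (hN k)
        have h1 := hU n hn2 k hnk q hq F hF
        have hsplit : |((Real.sqrt (Ns k))⁻¹ * as k ^ 4) ^ n| = (Real.sqrt (Ns k))⁻¹ ^ n * |as k ^ (4 * n)| := by
          rw [abs_pow, abs_mul, mul_pow, abs_inv, abs_of_pos hsq, ← abs_pow, ← pow_mul, mul_comm 4 n]
        rw [hsplit, mul_assoc]
        have h2 : |as k ^ (4 * n)| * ‖∑ x ∈ Fintype.piFinset (fun _ : Fin n => box 4 (Ls k)),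
            ((planeWeight r (βs k) (Ls k) q x : ℝ) : ℂ) * F (fun i => as k • siteToE (x i))‖ ≤
            (K * (n : ℝ) ^ γ * Real.sqrt (Ns k)) ^ n * schwartzNorm (s * n) F := by
          by_cases hpos : 0 ≤ as k ^ (4 * n)
          · rw [abs_of_nonneg hpos]; exact h1
          · -- impossible sign case handled crudely: `|t| x ≤ …` from `t x ≤ …` needs `t ≥ 0`; here `4n` is even
            exfalso; exact hpos (by rw [pow_mul]; exact pow_nonneg (by positivity) n)
        calc (Real.sqrt (Ns k))⁻¹ ^ n * (|as k ^ (4 * n)| * ‖∑ x ∈ Fintype.piFinset (fun _ : Fin n => box 4 (Ls k)),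
              ((planeWeight r (βs k) (Ls k) q x : ℝ) : ℂ) * F (fun i => as k • siteToE (x i))‖)
            ≤ (Real.sqrt (Ns k))⁻¹ ^ n * ((K * (n : ℝ) ^ γ * Real.sqrt (Ns k)) ^ n * schwartzNorm (s * n) F) :=
              mul_le_mul_of_nonneg_left h2 (by positivity)
          _ = (K * (n : ℝ) ^ γ) ^ n * schwartzNorm (s * n) F := by
              rw [mul_pow (K * (n : ℝ) ^ γ), ← mul_assoc, ← mul_assoc, mul_comm ((Real.sqrt (Ns k))⁻¹ ^ n),
                mul_assoc ((K * (n : ℝ) ^ γ) ^ n), ← mul_pow, inv_mul_cancel₀ hsq.ne', one_pow, mul_one]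
    · simpa using hrhs0
  obtain ⟨φ, hφ, S, hS, hconv⟩ := exists_subseq_clm_limit (X := X) T M (fun i => s * i.1)
    (fun i => (K * (i.1 : ℝ) ^ γ) ^ i.1) (fun i => by positivity) hbound
  refine ⟨φ, hφ, fun n q => S ⟨n, q⟩, fun n q F => hS ⟨n, q⟩ F, ?_, ?_⟩
  · -- convergence on `⁰𝒮` for non-degenerate strings
    intro n q hq F hF
    have h := hconv ⟨n, q⟩ F ((hM ⟨n, q⟩ F).2 hF)
    have hφk : ∀ k, k ≤ φ k := fun k => hφ.id_le k
    -- the approximants agree with the full sequence eventually (arity 0 and ≥ 2) or both vanish (arity 1)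
    rcases Nat.lt_or_ge n 2 with hn | hn
    · interval_cases n
      · refine h.congr' (Eventually.of_forall fun k => ?_)
        change (if (∀ j, (q j).1 ≠ (q j).2) ∧ (0 = 0 ∨ (2 ≤ 0 ∧ 0 ≤ φ k)) then Tfull ⟨0, q⟩ (φ k) else 0) F = _
        rw [if_pos ⟨hq, Or.inl rfl⟩]; rfl
      · -- arity 1: the full sequence is identically zero, and so are the approximants
        have hzero : ∀ k, ((lam 1 (φ k) : ℝ) : ℂ) * latticeDistStr r.ρ (βs (φ k)) (Ls (φ k)) (as (φ k))
            (fun i => planeObs r (q i)) (fun i => wilsonTorusMean r.ρ (βs (φ k)) (Ls (φ k)) (planeObs r (q i))) F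
            = 0 := fun k => by rw [latticeDistStr_planeObs_one, mul_zero]
        have happrox : ∀ k, T ⟨1, q⟩ (φ k) F = 0 := fun k => by
          change (if (∀ j, (q j).1 ≠ (q j).2) ∧ (1 = 0 ∨ (2 ≤ 1 ∧ 1 ≤ φ k)) then Tfull ⟨1, q⟩ (φ k) else 0) F = 0
          rw [if_neg (by rintro ⟨-, h | ⟨h, -⟩⟩ <;> omega)]; rfl
        simp_rw [happrox] at h
        simp_rw [hlam] at hzero ⊢
        simp_rw [hzero]
        exact h
    · refine h.congr' ?_
      filter_upwards [eventually_ge_atTop n] with k hk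
      change (if (∀ j, (q j).1 ≠ (q j).2) ∧ (n = 0 ∨ (2 ≤ n ∧ n ≤ φ k)) then Tfull ⟨n, q⟩ (φ k) else 0) F = _
      rw [if_pos ⟨hq, Or.inr ⟨hn, hk.trans (hφk k)⟩⟩]; rfl
  · -- E3, exactly, on `⁰𝒮`
    intro n q π F hF
    have hπF : IsOffDiagonal (permTest π F) := hF.permTest π
    have h1 := hconv ⟨n, q⟩ (permTest π F) ((hM ⟨n, q⟩ _).2 hπF)
    have h2 := hconv ⟨n, q ∘ π⟩ F ((hM ⟨n, q ∘ π⟩ _).2 hF)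
    refine tendsto_nhds_unique h1 (h2.congr fun k => ?_)
    -- the approximants agree term by term
    have hcond : ((∀ j, ((q ∘ π) j).1 ≠ ((q ∘ π) j).2) ∧ (n = 0 ∨ (2 ≤ n ∧ n ≤ φ k))) ↔
        ((∀ j, (q j).1 ≠ (q j).2) ∧ (n = 0 ∨ (2 ≤ n ∧ n ≤ φ k))) := by
      refine and_congr_left fun _ => ⟨fun h j => ?_, fun h j => h (π j)⟩
      simpa using h (π.symm j)
    change (if (∀ j, ((q ∘ π) j).1 ≠ ((q ∘ π) j).2) ∧ (n = 0 ∨ (2 ≤ n ∧ n ≤ φ k)) then Tfull ⟨n, q ∘ π⟩ (φ k) else 0) F =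
      (if (∀ j, (q j).1 ≠ (q j).2) ∧ (n = 0 ∨ (2 ≤ n ∧ n ≤ φ k)) then Tfull ⟨n, q⟩ (φ k) else 0) (permTest π F)
    by_cases hc : (∀ j, (q j).1 ≠ (q j).2) ∧ (n = 0 ∨ (2 ≤ n ∧ n ≤ φ k))
    · rw [if_pos (hcond.2 hc), if_pos hc, hTfull_apply, hTfull_apply, latticeDistStr_permTest]; rfl
    · rw [if_neg (fun h => hc (hcond.1 h)), if_neg hc]; rfl

end Summit.QuantumFields.YangMills.Cruxes.HypercubicLimit.ConditionalMeanTelescoping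

end
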